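import Literature.IUT.LogThetaLattice.GlobalPacketsLGP
import Literature.IUT.LogThetaLattice.PerpPrimeStrips
import Literature.IUT.LogThetaLattice.PilotWeights
import Literature.IUT.LogThetaLattice.LogWallRemarks
import Literature.IUT.LogThetaLattice.ThetaPilotObjects

/-!
# [IUTchIII] §2–§3 interfaces: NON-VACUITY witnesses (batch 1) — `LGPMonoidSignature`, `PicData`,
# `PlaceWeights`, `WeightConvention`, `PerpMonoidData`, `PerpLocalData`, `ThetaLinkStrips`

Mochizuki, *Inter-universal Teichmüller theory III*, §2 Def. 2.4 / Rmk. 2.4.2, §3 Prop. 3.4 (ii), Def. 3.8 (ii),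
kurims manuscript (May 2020) pp. 88–89, 102–103, 113 [claim: Mochizuki2012, status: disputed]
(IUTchIII §3 Prop 3.4 (ii), kurims pp.102-103). Record-only vocabulary under the claim key `Mochizuki2012`
(D-0012, disputed); abc-iut cell, layer L6, NON-VACUITY CERTIFICATES (cell referee protocol: a typed
interface all of whose consumers are conditional must be shown INHABITED). The INHABITATION CENSUS of the
L6 interfaces (abc-iut-w5-d114, `HOME/staging/w5/w5-d114/INHABITATION-CENSUS-L6-v3.md`, kernel-derived) found
NO term and NO existence theorem in the tree for the seven interfaces below; this file supplies the
cheapest honest witnesses and, where the typed laws constrain the PARAMETERS, the exact inhabitation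
condition:

* `LGPMonoidSignature.nonempty_iff` — abc-iut-L6-t4's OUTPUT SIGNATURE of [IUTchIII] Prop. 3.4 (ii)
  (`GlobalPacketsLGP.lean`; consumed by the Prop. 3.5 / 3.9 / Thm. 3.11 files) is inhabited over
  `(R, 𝓘^ℚ)` **iff `1 ∈ 𝓘^ℚ(^{S^±_{j+1},j;‡}𝓕_v)` for every `v, j`** (necessity: the unit portion is a
  submonoid, hence contains `1`, and is typed `⊆ 𝓘^ℚ`; sufficiency: all monoids trivial). For the genuine
  log-shells `𝓘^ℚ ⊇ 𝒪 ∋ 1` this holds; a consumer instantiating `IQ := ⊥` would be reasoning about the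
  empty interface.
* `PicData.standard`, `PlaceWeights.allBad`, `WeightConvention.const`, `PerpMonoidData.trivial`,
  `PerpLocalData.trivial`, `ThetaLinkStrips.const` — parameter / local-data records and the Def. 3.8 (ii)
  strip assignment, each inhabited outright (resp. over a nonempty finite `V`, resp. given one strip).

HONEST LABEL: degenerate witnesses (trivial monoids, one-point categories, constant assignments); they
certify joint satisfiability of the typed laws, nothing about the genuine objects (merge-gated on
abc-iut-L5/L6-t2 per the files' own TODO-merge notes). No `def … : Prop`, no instance, no named fact;
nothing here bears on [IUTchIII] Cor. 3.12; no side is taken.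
-/

noncomputable section

namespace Literature.IUT.LogThetaLattice

open CategoryTheory

universe u v w

/-! ## Prop. 3.4 (ii): the LGP-monoid output signature -/

namespace LGPMonoidSignature

variable {lstar : ℕ} {V : Type v} {isBad : V → Prop}
variable {R : V → Fin lstar → Type u} [∀ v j, CommRing (R v j)] [∀ v j, Algebra ℚ (R v j)]
variable {IQ : ∀ v j, Submodule ℚ (R v j)}

/-- **Necessity**: any LGP-monoid signature over `(R, 𝓘^ℚ)` forces `1 ∈ 𝓘^ℚ(^{S^±_{j+1},j;‡}𝓕_v)` at every
`(v, j)` — the unit portion `Ψ^×` is a submonoid (so contains `1`) and is typed `⊆ 𝓘^ℚ` (p. 103, second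
displayed property). [claim: Mochizuki2012, status: disputed] (IUTchIII §3 Prop 3.4 (ii), kurims p.103) -/
theorem one_mem_IQ (Ψ : LGPMonoidSignature lstar V isBad R IQ) (v : V) (j : Fin lstar) :
    (1 : R v j) ∈ IQ v j :=
  Ψ.unitsGal_subset v j (ΨUnitsGal Ψ v j).one_mem

/-- **Sufficiency — the DEGENERATE LGP-monoid signature**: every monoid `Ψ`, `_∞Ψ`, `Ψ^{Gal}`, `Ψ^×`, `Ψ^⊥`
trivial (`= {1}`); the two displayed properties of p. 103 then say exactly `1 ∈ 𝓘^ℚ` and `1 · m ∈ 𝓘^ℚ`.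
[claim: Mochizuki2012, status: disputed] (IUTchIII §3 Prop 3.4 (ii), kurims pp.102-103) -/
def trivial (h1 : ∀ v j, (1 : R v j) ∈ IQ v j) : LGPMonoidSignature lstar V isBad R IQ where
  Ψ _ _ := ⊥
  ΨInf _ _ := ⊥
  ΨGal _ _ := ⊥
  gal_le _ _ := le_refl _
  ΨUnitsGal _ _ := ⊥
  unitsGal_le _ _ := le_refl _
  ΨSplit _ _ _ := ⊥
  split_le _ _ _ := le_refl _
  bad_gal_subset v _ j := by
    intro x hx
    rw [SetLike.mem_coe, Submonoid.mem_bot] at hx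
    subst hx
    exact h1 v j
  bad_gal_acts v _ j := by
    intro x hx m hm
    rw [Submonoid.mem_bot] at hx
    subst hx
    simpa using hm
  unitsGal_subset v j := by
    intro x hx
    rw [SetLike.mem_coe, Submonoid.mem_bot] at hx
    subst hx
    exact h1 v j
  unitsGal_acts v j := by
    intro x hx m hm
    rw [Submonoid.mem_bot] at hx
    subst hx
    simpa using hm

/-- **The exact inhabitation condition of the Prop. 3.4 (ii) output signature**: it is inhabited over
`(R, 𝓘^ℚ)` iff `1 ∈ 𝓘^ℚ(^{S^±_{j+1},j;‡}𝓕_v)` for all `v, j`. [claim: Mochizuki2012, status: disputed]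
(IUTchIII §3 Prop 3.4 (ii), kurims pp.102-103) -/
theorem nonempty_iff :
    Nonempty (LGPMonoidSignature lstar V isBad R IQ) ↔ ∀ v j, (1 : R v j) ∈ IQ v j :=
  ⟨fun ⟨Ψ⟩ => Ψ.one_mem_IQ, fun h => ⟨trivial h⟩⟩

end LGPMonoidSignature

/-! ## Rmk. 2.4.2 (i)(ii) / Def. 2.4: parameter and local-data records -/

/-- **`PicData` is inhabited**: `Pic ≅ ℝ` the identity, pilot element `η := −1 < 0` (Rmk. 2.4.2 (i), p. 89:
"isomorphic [as an ordered monoid] to `ℝ` … a negative element"). [claim: Mochizuki2012, status: disputed]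
(IUTchIII §2 Rmk 2.4.2 (i), kurims p.89) -/
def PicData.standard : PicData.{0} where
  M := ℝ
  isoReal := OrderAddMonoidIso.refl ℝ
  η := -1
  η_neg := by
    show ((OrderAddMonoidIso.refl ℝ) (-1 : ℝ)) < 0
    simp

/-- `PicData` has a term. [claim: Mochizuki2012, status: disputed] (IUTchIII §2 Rmk 2.4.2 (i), kurims p.89) -/
theorem PicData.nonempty : Nonempty PicData.{0} := ⟨PicData.standard⟩

/-- **`PlaceWeights V` is inhabited over every nonempty finite `V`**: all places bad and nonarchimedean,
local degree `1`, `log(p_v) := 1 > 0` (a formal positive weight), `ord_v(q_v) := 1 > 0` (Rmk. 2.4.2 (ii), p. 89; [IUTchI] Def. 3.1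
(b): `V̲^bad ≠ ∅`). DEGENERATE (no archimedean place). [claim: Mochizuki2012, status: disputed]
(IUTchIII §2 Rmk 2.4.2 (ii), kurims p.89) -/
def PlaceWeights.allBad (V : Type*) [Fintype V] [Nonempty V] : PlaceWeights V where
  isBad _ := True
  isArc _ := False
  not_isArc_of_isBad _ _ := fun h => h
  exists_isBad := ⟨Classical.arbitrary V, True.intro⟩
  deg _ := 1
  deg_pos _ := Nat.one_pos
  logp _ := 1
  logp_pos _ := one_pos
  logp_arc _ h := h.elim
  ordq _ := 1
  ordq_pos _ _ := one_pos

/-- `PlaceWeights V` has a term iff `V` is nonempty (a bad place must exist).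
[claim: Mochizuki2012, status: disputed] (IUTchIII §2 Rmk 2.4.2 (ii), kurims p.89) -/
theorem PlaceWeights.nonempty_iff (V : Type*) [Fintype V] : Nonempty (PlaceWeights V) ↔ Nonempty V :=
  ⟨fun ⟨W⟩ => let ⟨v, _⟩ := W.exists_isBad; ⟨v⟩, fun ⟨v⟩ => by
    haveI : Nonempty V := ⟨v⟩
    exact ⟨PlaceWeights.allBad V⟩⟩

/-- **`WeightConvention A μ_N` is inhabited** for every `(A, μ_N)`: the constant log-volume `0` on every
subset (Rmk. 1.2.2 weight convention, [IUTchIII] p. 37 — DEGENERATE: certifies only that the convention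
`logVolQuot (image S) = logVol S` is satisfiable). [claim: Mochizuki2012, status: disputed]
(IUTchIII §1 Rmk 1.2.2, kurims p.37) -/
def WeightConvention.const (A : Type u) [CommGroup A] (μN : Subgroup A) : WeightConvention A μN where
  logVol _ := some 0
  logVolQuot _ := some 0
  weight_convention _ _ := rfl

/-- `WeightConvention A μ_N` has a term. [claim: Mochizuki2012, status: disputed] (IUTchIII §1 Rmk 1.2.2, kurims p.37) -/
theorem WeightConvention.nonempty (A : Type u) [CommGroup A] (μN : Subgroup A) :
    Nonempty (WeightConvention A μN) := ⟨WeightConvention.const A μN⟩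

/-- **`PerpMonoidData` is inhabited**: `O^▷ := ℕ` (written multiplicatively), `O^⊥ := O^▷` (Def. 2.4 (i),
p. 88). [claim: Mochizuki2012, status: disputed] (IUTchIII §2 Def 2.4 (i), kurims p.88) -/
def PerpMonoidData.trivial : PerpMonoidData.{u} where
  O := ULift.{u} (Multiplicative ℕ)
  perp := ⊤

/-- `PerpMonoidData` has a term. [claim: Mochizuki2012, status: disputed] (IUTchIII §2 Def 2.4 (i), kurims p.88) -/
theorem PerpMonoidData.nonempty : Nonempty PerpMonoidData.{u} := ⟨PerpMonoidData.trivial⟩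

/-- **`PerpLocalData V` is inhabited over every `V`**: one-point ambient categories at every place, identity
functors, the monoid data `PerpMonoidData.trivial` (Def. 2.4 (i)–(ii), p. 88 — DEGENERATE STUB witness;
the file's own docstring says the stub does not tie `toPerp`/`toTri` to the Frobenioids).
[claim: Mochizuki2012, status: disputed] (IUTchIII §2 Def 2.4 (i), kurims p.88) -/
def PerpLocalData.trivial (V : Type w) : PerpLocalData.{u, w} V where
  Fv _ := Discrete PUnit.{u + 1}
  Fperp _ := Discrete PUnit.{u + 1}
  Ftri _ := Discrete PUnit.{u + 1}
  modelFv _ := ⟨PUnit.unit⟩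
  toPerp _ := 𝟭 _
  toTri _ := 𝟭 _
  monoids _ _ := PerpMonoidData.trivial

/-- `PerpLocalData V` has a term. [claim: Mochizuki2012, status: disputed] (IUTchIII §2 Def 2.4 (i), kurims p.88) -/
theorem PerpLocalData.nonempty (V : Type w) : Nonempty (PerpLocalData.{u, w} V) := ⟨PerpLocalData.trivial V⟩

/-! ## Def. 3.8 (ii): the strip assignment of the Θ^{×μ}_{LGP}-link -/

section Links

variable {HT : Type u} {LogLink : HT → HT → Type v} {Strip : Type u}

/-- **`ThetaLinkStrips` is inhabited as soon as ONE `𝓕^{⊩▶×μ}`-prime-strip exists**: every log-link and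
every Hodge theater is sent to that strip (Def. 3.8 (ii), p. 113 — DEGENERATE: the three assignments
coincide). [claim: Mochizuki2012, status: disputed] (IUTchIII §3 Def 3.8 (ii), kurims p.113) -/
def ThetaLinkStrips.const (X : Strip) : ThetaLinkStrips LogLink Strip where
  stripLGP _ := X
  stripLgp _ := X
  stripDelta _ := X

/-- `ThetaLinkStrips` has a term iff the strip type is nonempty or there is no Hodge theater at all; in
particular it is inhabited whenever a strip exists. [claim: Mochizuki2012, status: disputed]
(IUTchIII §3 Def 3.8 (ii), kurims p.113) -/
theorem ThetaLinkStrips.nonempty_of_strip (X : Strip) : Nonempty (ThetaLinkStrips LogLink Strip) :=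
  ⟨ThetaLinkStrips.const X⟩

/-- Conversely a Hodge theater forces a strip (`*𝔉^{⊩▶×μ}_△` of it). [claim: Mochizuki2012, status: disputed]
(IUTchIII §3 Def 3.8 (ii), kurims p.113) -/
theorem ThetaLinkStrips.nonempty_strip (D : ThetaLinkStrips LogLink Strip) (star : HT) : Nonempty Strip :=
  ⟨D.stripDelta star⟩

end Links

end Literature.IUT.LogThetaLattice

end
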